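/-
Copyright (c) 2026 the pub-hodgecm-mathlib formalisation cell (harness21).  Prover seat hodgecm-mathlib-LH4-p09 (g8), req620 Track A «(D-RAM) FOUR-FRAME» squad
(heir LEAD F0P3a-plan (g20) T19-24 «STAGE-1b PRE-SCOPING BY IDLE HANDS: ALLOWED AS SCOPING»; dealer LH4-plan (g12)).  2026-09-04.
-/
import Summits.HodgeConjecture.HodgeConjecture.Theorems.F0P3cDyRamFixedCountDiagonalModel   -- ★ (LH4-p11 (g0)): `exists_unimodular_diagonal_frame`, `ncard_fixed_formCongr_eq`; brings ★ #0a `UnitaryThreeFourFrameDefs`, ★ `UnitaryLatticeTreeFormTransport`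
import Summits.HodgeConjecture.HodgeConjecture.Theorems.F0P3cDyRamFourFrameCensusDefs       -- ★ U2G DEFS LEAF (B-p08 (g41)): `LatticeInLevel`, `LatticeNearTransvShell`, `regFixCount`
import HarnessLib

/-!
# Crux `H413`, line LH4 «(D-RAM) FOUR-FRAME» road — STAGE-1b SCOPING BRICK «(L-model)»: THE LEVEL ∕ PROFILE CENSUS OF A FRAME ELEMENT IN THE UNIMODULAR
# DIAGONAL MODEL (the level-currency twin of ★ `F0P3cDyRamFixedCountDiagonalModel`: steps (1) «form transport + frame rescaling» and (2) «class-only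
# dependence» of the (S)∕(K) reductions of record, for every level ∕ profile count of the STAGE-1b rows)

Cell `hodgecm-mathlib` (D-0151), FLOOR 0, crux item H413 = `stmt-HodgeConjecture-24833`, route of record `HCCMUnconditional`; squad F0∕P3c∕LH4 (req618∕req620).
THEOREMS ONLY (no `def`, no instance, no notation, no `sorry`, default heartbeats); lane `--supports stmt-HodgeConjecture-24833 --as helper` (count-neutral).
Consumers: the STAGE-1b producers of the tier-0 rows `stub_rows_transvPlus ∕ _transvMinus ∕ _regular` (`Cruxes/H413/Lines/F0_P3c_DyRamFourFrame.lean` @85∕89∕93),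
whose G-side censuses read (★ `F0P3cDyRamPieceCountDictionaryProfiles`, (D-G-levels)) in ONE currency: the number of type-`0` vertices `M` of the tree of `(K³, Φ₃)`
with `Γ·M = M ∧ (Γ − 1)·M ⊆ ϖ^a·M ∧ (Γ − 1)²·M ⊆ ϖ^c·M` (★ U2G DEFS `LatticeInLevel`) and its square-level ∕ `regFixCount` ∕ shell variants, `Γ = Γ_b(α, β)`.

THE MATHEMATICS ([BruhatTits1972, §10]; [Jacobowitz1962, §4]; [Kottwitz1986BaseChangeUnits, §1]; [Rogawski1990, §4.9 p. 55]).  (T) For `P ∈ GL_N(K)`, `M ↦ P·M`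
carries the type-`t` vertices of `ᵗσ(P)·H·P` onto those of `H` (★ `isVertexLattice_formCongr_iff`), fixedness `T·M = M` onto `(PTP⁻¹)·(P·M) = P·M` (★
`mapGL_conj_mapGL_eq_iff`) and EVERY LEVEL TOKEN `X·M ⊆ ϖ^ℓ·M` onto `(PXP⁻¹)·(P·M) ⊆ ϖ^ℓ·(P·M)` (★ `map_toLin'_conj_mapGL_le_scaleLattice_iff`); so any count of fixed
type-`t` vertices cut out by level tokens of polynomials in `T` agrees in the two models (§2; type-`t`, generic-label twin of ★ `ncard_selfDual_fixed_sep_eq_of_formCongr`).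
(F) ★ `exists_unimodular_diagonal_frame`: `A ∈ GL₃(K)` and a UNIT diagonal form `diag(d)` (`|d_i| = 1`, `σ d_i = d_i`, `ω(d_i) = ω(N_i)`) with `ᵗσ(A)Φ₃A = diag(d)`,
`Γ_b(α, β) = A·diag(α, β, 1)·A⁻¹`; there the level operators are EXPLICIT DIAGONAL MATRICES `diag(α − 1, β − 1, 0)`, `diag((α − 1)², (β − 1)², 0)` (§1; `diag(zα − 1,
zβ − 1, z − 1)` for the literal `z·Γ_b` — MASTER head + `eq_conj_of_coe_eq_smul_frameElt` + the §2 helpers at `s = (zα, zβ, z)`).  Hence (§3) every level ∕ profile count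
of `Γ_b` is a count of type-`t` vertices of `(K³, diag(d))` fixed by `diag(α, β, 1)` and cut out by diagonal operators — the input currency of the ★ Stage-A∕B engines
(`normalisedStableLattices (diag s)`, strata by axis).  (C) `diag(z)` commutes with every diagonal operator, so the model counts see `d` only through `d_i·N(E^×)` (§2).
§1 matrix algebra (conjugation, the diagonal operators); §2 token ∕ count transport, the helpers `ncard_levels ∕ ncard_sqLevel ∕ regFixCount ∕ ncard_shell _conj_diagonal`
(any model `ᵗσ(A)Φ₃A = H′`, any diagonal `T`) and (C) `ncard_vertex_fixed_sep_diagonal_eq_of_exists_norm` (levels label: discharge `hQ` by `latticeInLevel_diagonal_mapGL_iff`);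
§3 `fixedVertexCount_conj`, MASTER `exists_diagonal_model_frame` (explicit `A`, `d`, generic label), HEAD `exists_diagonal_model_levelCounts` (all counts in ONE model).
NOT INCLUDED (by design): the `T₊` LABEL token (★ U2G DEFS `latticeValueSetMod` hard-wires `Φ₃`; the value token transports by ★ `exists_mem_mapGL_pairing_conj_iff` once
a form-parametrised label is cut), any census LAW, any count VALUE.
HONEST LABEL.  Count-neutral (`--supports`); a change of model, nothing printed is asserted; pays NO tier-0 row (rows T± ∕ regular stay `sorry` until the STAGE-1b
directive); the census laws stay PROVER TARGETS; the verdict of record for (D-RAM) stays PRINT [LanglandsShelstad1989 Thm. p. 484 ∕ Rogawski1990 Prop. 4.9.1 (a)] ∕ XL;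
`HC_CM` is proved only modulo the 7 printed citations (2 remaining named inputs: hLiu418 = `stmt-HodgeConjecture-24832`, h413 = `stmt-HodgeConjecture-24833`) until rung 0 closes.

## References
* [BruhatTits1972] F. Bruhat, J. Tits, *Groupes réductifs sur un corps local I*, Publ. Math. IHÉS 41 (1972), §10 (lattice models of the building of a unitary group).
* [Jacobowitz1962] R. Jacobowitz, *Hermitian forms over local fields*, Amer. J. Math. 84 (1962), §4 (Gram matrices, scaling, norm classes).
* [Kottwitz1986BaseChangeUnits] R. E. Kottwitz, *Base change for unit elements of Hecke algebras*, Compositio Math. 60 (1986), §1 pp. 240–241 (fixed-lattice counting).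
* [Rogawski1990] J. D. Rogawski, *Automorphic Representations of Unitary Groups in Three Variables*, Ann. of Math. Stud. 123 (1990), §3.6 pp. 28–29, §4.9 Prop. 4.9.1
  (a)(b) p. 55, Lemma 4.9.3 p. 56 (orbital integrals of congruence-level indicators as fixed-lattice counts).
-/

set_option autoImplicit false

noncomputable section

namespace Summit.HodgeConjecture.HodgeConjecture.Cruxes.H413.F0P3cDyRamLevelCountDiagonalModel

open Literature.NumberTheory.Automorphic Literature.NumberTheory.Automorphic.HermitianLattice Literature.NumberTheory.Automorphic.UnitaryGroup
open Literature.NumberTheory.Automorphic.UnitaryLatticeTree Literature.NumberTheory.Automorphic.UnitaryThreeFourFrame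
open Summit.HodgeConjecture.HodgeConjecture.Cruxes.H413.F0P3cDyRamFourFrameCensusDefs
open Summit.HodgeConjecture.HodgeConjecture.Cruxes.H413.F0P3cDyRamFixedCountDiagonalModel
open scoped Valued WithZero Matrix MatrixGroups

/-! ## §1  Matrix algebra of the diagonal model: conjugation, and the level operators as explicit diagonal matrices -/

section Model

variable {K : Type*} [Field K] {N : ℕ}

/-- `(PTP⁻¹) − 1 = P (T − 1) P⁻¹` (the ★ `UnitaryLatticeTreeFormTransport` copy is file-private). [cite: Kottwitz1986BaseChangeUnits, §1 pp. 240–241] -/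
theorem coe_conj_sub_one (P T : GL (Fin N) K) :
    ((P * T * P⁻¹ : GL (Fin N) K) : Matrix (Fin N) (Fin N) K) - 1 =
      (P : Matrix (Fin N) (Fin N) K) * ((T : Matrix (Fin N) (Fin N) K) - 1) * ((P⁻¹ : GL (Fin N) K) : Matrix (Fin N) (Fin N) K) := by
  rw [Matrix.mul_sub, Matrix.sub_mul, Matrix.mul_one, Units.val_mul, Units.val_mul, Units.mul_inv]

/-- Conjugation is multiplicative: `(P X P⁻¹)·(P Y P⁻¹) = P (X·Y) P⁻¹`. [cite: Kottwitz1986BaseChangeUnits, §1 pp. 240–241] -/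
theorem conj_mul_conj (P : GL (Fin N) K) (X Y : Matrix (Fin N) (Fin N) K) :
    (P : Matrix (Fin N) (Fin N) K) * X * ((P⁻¹ : GL (Fin N) K) : Matrix (Fin N) (Fin N) K) *
        ((P : Matrix (Fin N) (Fin N) K) * Y * ((P⁻¹ : GL (Fin N) K) : Matrix (Fin N) (Fin N) K)) =
      (P : Matrix (Fin N) (Fin N) K) * (X * Y) * ((P⁻¹ : GL (Fin N) K) : Matrix (Fin N) (Fin N) K) := by
  simp only [Matrix.mul_assoc]
  rw [← Matrix.mul_assoc ((P⁻¹ : GL (Fin N) K) : Matrix (Fin N) (Fin N) K) (P : Matrix (Fin N) (Fin N) K), Units.inv_mul, Matrix.one_mul]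

/-- `((PTP⁻¹) − 1)·((PTP⁻¹) − 1) = P ((T − 1)·(T − 1)) P⁻¹` — the square-level operator of the conjugate (★ U2G DEFS spell the square as a product).
[cite: Kottwitz1986BaseChangeUnits, §1 pp. 240–241] -/
theorem coe_conj_sub_one_mul_self (P T : GL (Fin N) K) :
    (((P * T * P⁻¹ : GL (Fin N) K) : Matrix (Fin N) (Fin N) K) - 1) * (((P * T * P⁻¹ : GL (Fin N) K) : Matrix (Fin N) (Fin N) K) - 1) =
      (P : Matrix (Fin N) (Fin N) K) * (((T : Matrix (Fin N) (Fin N) K) - 1) * ((T : Matrix (Fin N) (Fin N) K) - 1)) *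
        ((P⁻¹ : GL (Fin N) K) : Matrix (Fin N) (Fin N) K) := by
  rw [coe_conj_sub_one, conj_mul_conj]

/-- A diagonal change of basis fixes every diagonal operator: `P·diag(e)·P⁻¹ = diag(e)` for `P = diag(z) ∈ GL_N`. [cite: Jacobowitz1962, §4] -/
theorem diagonal_conj_diagonal {P : GL (Fin N) K} {z : Fin N → K} (hP : (P : Matrix (Fin N) (Fin N) K) = Matrix.diagonal z) (e : Fin N → K) :
    (P : Matrix (Fin N) (Fin N) K) * Matrix.diagonal e * ((P⁻¹ : GL (Fin N) K) : Matrix (Fin N) (Fin N) K) = Matrix.diagonal e := by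
  have hcomm : (P : Matrix (Fin N) (Fin N) K) * Matrix.diagonal e = Matrix.diagonal e * (P : Matrix (Fin N) (Fin N) K) := by
    rw [hP, Matrix.diagonal_mul_diagonal, Matrix.diagonal_mul_diagonal]
    congr 1
    funext i
    exact mul_comm _ _
  rw [hcomm, Matrix.mul_assoc, Units.mul_inv, Matrix.mul_one]

/-- Scalars pass through a conjugation: `z·(A D B) = A (z·D) B`. [cite: Rogawski1990, §4.9 p. 54] -/
theorem smul_conj (z : K) (A D B : Matrix (Fin N) (Fin N) K) : z • (A * D * B) = A * (z • D) * B := by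
  rw [Matrix.mul_smul, Matrix.smul_mul]

/-- `diag(s) − 1 = diag(s_i − 1)`. [cite: Rogawski1990, §3.6 pp. 28–29] -/
theorem diagonal_sub_one (s : Fin N → K) : Matrix.diagonal s - 1 = Matrix.diagonal (fun i => s i - 1) := by
  ext i j
  by_cases h : i = j
  · subst h
    simp only [Matrix.sub_apply, Matrix.diagonal_apply_eq, Matrix.one_apply_eq]
  · simp only [Matrix.sub_apply, Matrix.diagonal_apply_ne _ h, Matrix.one_apply_ne h, sub_zero]

/-- `(diag(s) − 1)·(diag(s) − 1) = diag((s_i − 1)·(s_i − 1))`. [cite: Rogawski1990, §3.6 pp. 28–29] -/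
theorem diagonal_sub_one_mul_self (s : Fin N → K) :
    (Matrix.diagonal s - 1) * (Matrix.diagonal s - 1) = Matrix.diagonal (fun i => (s i - 1) * (s i - 1)) := by
  rw [diagonal_sub_one, Matrix.diagonal_mul_diagonal]

/-- The literal's operator: `diag(a, b, c) − 1 = diag(a − 1, b − 1, c − 1)` (for `T = diag(zα, zβ, z)`; at `z = 1`, `diag(α − 1, β − 1, 0)`).
[cite: Rogawski1990, §4.9 p. 54] -/
theorem diagonal_three_sub_one (a b c : K) : Matrix.diagonal ![a, b, c] - 1 = Matrix.diagonal ![a - 1, b - 1, c - 1] := by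
  rw [diagonal_sub_one]
  congr 1
  funext i
  fin_cases i <;> simp

/-- Its square: `(diag(a, b, c) − 1)·(diag(a, b, c) − 1) = diag((a − 1)², (b − 1)², (c − 1)²)` (products spelled `x·x` as in ★ U2G DEFS).
[cite: Rogawski1990, §4.9 p. 54] -/
theorem diagonal_three_sub_one_mul_self (a b c : K) :
    (Matrix.diagonal ![a, b, c] - 1) * (Matrix.diagonal ![a, b, c] - 1) = Matrix.diagonal ![(a - 1) * (a - 1), (b - 1) * (b - 1), (c - 1) * (c - 1)] := by
  rw [diagonal_sub_one_mul_self]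
  congr 1
  funext i
  fin_cases i <;> simp

/-- The literal `z·diag(α, β, 1) = diag(zα, zβ, z)`. [cite: Rogawski1990, §4.9 p. 54] -/
theorem smul_diagonal_three_one (z α β : K) : z • Matrix.diagonal ![α, β, 1] = Matrix.diagonal ![z * α, z * β, z] := by
  rw [← Matrix.diagonal_smul]
  congr 1
  funext i
  fin_cases i <;> simp

end Model

/-! ## §2  Transport of level tokens and label-cut fixed counts under `M ↦ P·M`, `T ↦ PTP⁻¹`; the counts of a conjugate of a diagonal matrix; class-only dependence -/

section Transport

variable {K : Type*} [Field K] [Valued K ℤᵐ⁰] {N : ℕ}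

/-- **THE LEVEL TOKEN OF THE CENSUS DEFS TRANSPORTS**: `LatticeInLevel ϖ ℓ (PXP⁻¹) (P·M) ↔ LatticeInLevel ϖ ℓ X M` (★ `map_toLin'_conj_mapGL_le_scaleLattice_iff`
in the ★ U2G DEFS currency). [cite: Kottwitz1986BaseChangeUnits, §1 pp. 240–241] [cite: Rogawski1990, §4.9 Lemma 4.9.3 p. 56] -/
theorem latticeInLevel_conj_mapGL_iff (P : GL (Fin 3) K) (ϖ : K) (ℓ : ℕ) (X : Matrix (Fin 3) (Fin 3) K) (M : Submodule 𝒪[K] (Fin 3 → K)) :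
    LatticeInLevel ϖ ℓ ((P : Matrix (Fin 3) (Fin 3) K) * X * ((P⁻¹ : GL (Fin 3) K) : Matrix (Fin 3) (Fin 3) K)) (mapGL P M) ↔ LatticeInLevel ϖ ℓ X M := by
  unfold LatticeInLevel
  exact map_toLin'_conj_mapGL_le_scaleLattice_iff P X (ϖ ^ ℓ) M

/-- **THE (UNLABELLED) SHELL TOKEN TRANSPORTS**: `LatticeNearTransvShell ϖ ℓ m (PXP⁻¹) (P·M) ↔ LatticeNearTransvShell ϖ ℓ m X M`.
[cite: Kottwitz1986BaseChangeUnits, §1 pp. 240–241] [cite: Rogawski1990, §4.9 Prop. 4.9.1 (b) p. 55] -/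
theorem latticeNearTransvShell_conj_mapGL_iff (P : GL (Fin 3) K) (ϖ : K) (ℓ m : ℕ) (X : Matrix (Fin 3) (Fin 3) K) (M : Submodule 𝒪[K] (Fin 3 → K)) :
    LatticeNearTransvShell ϖ ℓ m ((P : Matrix (Fin 3) (Fin 3) K) * X * ((P⁻¹ : GL (Fin 3) K) : Matrix (Fin 3) (Fin 3) K)) (mapGL P M) ↔
      LatticeNearTransvShell ϖ ℓ m X M := by
  unfold LatticeNearTransvShell
  rw [conj_mul_conj, latticeInLevel_conj_mapGL_iff, latticeInLevel_conj_mapGL_iff, latticeInLevel_conj_mapGL_iff]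

/-- **(T) COUNT TRANSPORT WITH A GENERIC LABEL, ANY VERTEX TYPE.**  If a label `Q₁` of lattices in the `H`-model corresponds to `Q₂` in the `ᵗσ(P)HP`-model under
`M ↦ P·M`, then `#{M : type t for ᵗσ(P)HP, T·M = M, Q₂ M} = #{M : type t for H, (PTP⁻¹)·M = M, Q₁ M}` — the second set is the image of the first under the injection
`mapGL P` (type-`t` twin of ★ `ncard_selfDual_fixed_sep_eq_of_formCongr`; `Q ≡ True` is ★ `ncard_fixed_formCongr_eq`).
[cite: BruhatTits1972, §10] [cite: Kottwitz1986BaseChangeUnits, §1 pp. 240–241] -/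
theorem ncard_vertex_fixed_sep_formCongr_eq (σ : K →+* K) (ϖ : K) (H : Matrix (Fin N) (Fin N) K) (P T : GL (Fin N) K) (t : ℕ)
    (Q₁ Q₂ : Submodule 𝒪[K] (Fin N → K) → Prop) (hQ : ∀ M, Q₁ (mapGL P M) ↔ Q₂ M) :
    {M : Submodule 𝒪[K] (Fin N → K) | IsVertexLattice σ ϖ (formCongr σ P H) t M ∧ mapGL T M = M ∧ Q₂ M}.ncard =
      {M : Submodule 𝒪[K] (Fin N → K) | IsVertexLattice σ ϖ H t M ∧ mapGL (P * T * P⁻¹) M = M ∧ Q₁ M}.ncard := by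
  have himage : {M : Submodule 𝒪[K] (Fin N → K) | IsVertexLattice σ ϖ H t M ∧ mapGL (P * T * P⁻¹) M = M ∧ Q₁ M} =
      mapGL P '' {M : Submodule 𝒪[K] (Fin N → K) | IsVertexLattice σ ϖ (formCongr σ P H) t M ∧ mapGL T M = M ∧ Q₂ M} := by
    ext M'
    simp only [Set.mem_setOf_eq, Set.mem_image]
    constructor
    · rintro ⟨hv, hfix, hQ₁⟩
      have hM' : mapGL P (mapGL P⁻¹ M') = M' := mapGL_mapGL_inv P M'
      refine ⟨mapGL P⁻¹ M', ⟨?_, ?_, ?_⟩, hM'⟩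
      · rw [isVertexLattice_formCongr_iff (σ := σ) (ϖ := ϖ), hM']
        exact hv
      · rw [← mapGL_conj_mapGL_eq_iff P, hM']
        exact hfix
      · rw [← hQ, hM']
        exact hQ₁
    · rintro ⟨M, ⟨hv, hfix, hQ₂⟩, rfl⟩
      exact ⟨(isVertexLattice_formCongr_iff (σ := σ) (ϖ := ϖ) P H t M).1 hv, (mapGL_conj_mapGL_eq_iff P T M).2 hfix, (hQ M).2 hQ₂⟩
  rw [himage, Set.ncard_image_of_injective _ (mapGL_injective P)]

/-- **LEVELS COUNT OF A CONJUGATE OF A DIAGONAL MATRIX** (any model `ᵗσ(A)·Φ₃·A = H′`, any vertex type): for `Γ = A·T·A⁻¹`, `T = diag(s)`,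
`#{M : type t for Φ₃, Γ·M = M, (Γ−1)M ⊆ ϖ^aM, (Γ−1)²M ⊆ ϖ^cM} = #{M : type t for H′, T·M = M, diag(s−1)M ⊆ ϖ^aM, diag((s−1)²)M ⊆ ϖ^cM}` — LH4-p06 (g6)'s (D-G-levels)
count currency on the left, token for token. [cite: Kottwitz1986BaseChangeUnits, §1 pp. 240–241] [cite: BruhatTits1972, §10] -/
theorem ncard_levels_conj_diagonal (σ : K →+* K) (ϖ : K) {H' : Matrix (Fin 3) (Fin 3) K} {A T Γ : GL (Fin 3) K}
    (hA : formCongr σ A ((StdForm.antidiagonal 3).over K) = H') (hΓ : Γ = A * T * A⁻¹) {s : Fin 3 → K} (hT : (T : Matrix (Fin 3) (Fin 3) K) = Matrix.diagonal s)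
    (t a c : ℕ) :
    {M : Submodule 𝒪[K] (Fin 3 → K) | IsVertexLattice σ ϖ ((StdForm.antidiagonal 3).over K) t M ∧ mapGL Γ M = M ∧
        (LatticeInLevel ϖ a ((Γ : Matrix (Fin 3) (Fin 3) K) - 1) M ∧
          LatticeInLevel ϖ c (((Γ : Matrix (Fin 3) (Fin 3) K) - 1) * ((Γ : Matrix (Fin 3) (Fin 3) K) - 1)) M)}.ncard =
      {M : Submodule 𝒪[K] (Fin 3 → K) | IsVertexLattice σ ϖ H' t M ∧ mapGL T M = M ∧
        (LatticeInLevel ϖ a (Matrix.diagonal fun i => s i - 1) M ∧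
          LatticeInLevel ϖ c (Matrix.diagonal fun i => (s i - 1) * (s i - 1)) M)}.ncard := by
  subst hΓ
  rw [← hA, ← diagonal_sub_one, ← diagonal_sub_one_mul_self, ← hT]
  refine (ncard_vertex_fixed_sep_formCongr_eq σ ϖ ((StdForm.antidiagonal 3).over K) A T t _ _ fun M => ?_).symm
  rw [coe_conj_sub_one_mul_self, coe_conj_sub_one, latticeInLevel_conj_mapGL_iff, latticeInLevel_conj_mapGL_iff]

/-- **SQUARE-LEVEL COUNT OF A CONJUGATE OF A DIAGONAL MATRIX**: `#{M : type t for Φ₃, Γ·M = M, (Γ−1)²M ⊆ ϖ^cM} = #{M : type t for H′, T·M = M, diag((s−1)²)M ⊆ ϖ^cM}`.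
[cite: Kottwitz1986BaseChangeUnits, §1 pp. 240–241] [cite: BruhatTits1972, §10] -/
theorem ncard_sqLevel_conj_diagonal (σ : K →+* K) (ϖ : K) {H' : Matrix (Fin 3) (Fin 3) K} {A T Γ : GL (Fin 3) K}
    (hA : formCongr σ A ((StdForm.antidiagonal 3).over K) = H') (hΓ : Γ = A * T * A⁻¹) {s : Fin 3 → K} (hT : (T : Matrix (Fin 3) (Fin 3) K) = Matrix.diagonal s)
    (t c : ℕ) :
    {M : Submodule 𝒪[K] (Fin 3 → K) | IsVertexLattice σ ϖ ((StdForm.antidiagonal 3).over K) t M ∧ mapGL Γ M = M ∧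
        LatticeInLevel ϖ c (((Γ : Matrix (Fin 3) (Fin 3) K) - 1) * ((Γ : Matrix (Fin 3) (Fin 3) K) - 1)) M}.ncard =
      {M : Submodule 𝒪[K] (Fin 3 → K) | IsVertexLattice σ ϖ H' t M ∧ mapGL T M = M ∧
        LatticeInLevel ϖ c (Matrix.diagonal fun i => (s i - 1) * (s i - 1)) M}.ncard := by
  subst hΓ
  rw [← hA, ← diagonal_sub_one_mul_self, ← hT]
  refine (ncard_vertex_fixed_sep_formCongr_eq σ ϖ ((StdForm.antidiagonal 3).over K) A T t _ _ fun M => ?_).symm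
  rw [coe_conj_sub_one_mul_self, latticeInLevel_conj_mapGL_iff]

/-- **REGULAR-PROFILE COUNT OF A CONJUGATE OF A DIAGONAL MATRIX**: `regFixCount σ ϖ m Γ = #{M : type 0 for H′, T·M = M, ¬ diag((s−1)²)M ⊆ ϖ^mM}` (★ U2G DEFS
`regFixCount`, the count the piece `f_reg` sees). [cite: Kottwitz1986BaseChangeUnits, §1 pp. 240–241] [cite: Rogawski1990, §4.9 Prop. 4.9.1 (b) p. 55] -/
theorem regFixCount_conj_diagonal (σ : K →+* K) (ϖ : K) {H' : Matrix (Fin 3) (Fin 3) K} {A T Γ : GL (Fin 3) K}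
    (hA : formCongr σ A ((StdForm.antidiagonal 3).over K) = H') (hΓ : Γ = A * T * A⁻¹) {s : Fin 3 → K} (hT : (T : Matrix (Fin 3) (Fin 3) K) = Matrix.diagonal s)
    (m : ℕ) :
    regFixCount σ ϖ m Γ =
      {M : Submodule 𝒪[K] (Fin 3 → K) | IsVertexLattice σ ϖ H' 0 M ∧ mapGL T M = M ∧
        ¬ LatticeInLevel ϖ m (Matrix.diagonal fun i => (s i - 1) * (s i - 1)) M}.ncard := by
  subst hΓ
  unfold regFixCount
  rw [← hA, ← diagonal_sub_one_mul_self, ← hT]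
  refine (ncard_vertex_fixed_sep_formCongr_eq σ ϖ ((StdForm.antidiagonal 3).over K) A T 0 _ _ fun M => ?_).symm
  rw [coe_conj_sub_one_mul_self, latticeInLevel_conj_mapGL_iff]

/-- **SHELL COUNT (UNLABELLED) OF A CONJUGATE OF A DIAGONAL MATRIX**: `#{M : type t for Φ₃, Γ·M = M, LatticeNearTransvShell ϖ ℓ m (Γ−1) M} =
#{M : type t for H′, T·M = M, diag(s−1)M ⊆ ϖ^ℓM ∧ ¬ diag(s−1)M ⊆ ϖ^{ℓ+1}M ∧ diag((s−1)²)M ⊆ ϖ^mM}` (the sum `transvPlusFixCount + transvMinusFixCount` of ★ U2G DEFS at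
`t = 0`, ★ `F0P3cDyRamFrameEltLevelAlgebra.transvPlusFixCount_add_transvMinusFixCount`). [cite: Kottwitz1986BaseChangeUnits, §1 pp. 240–241] [cite: Rogawski1990, §4.9 Prop. 4.9.1 (b) p. 55] -/
theorem ncard_shell_conj_diagonal (σ : K →+* K) (ϖ : K) {H' : Matrix (Fin 3) (Fin 3) K} {A T Γ : GL (Fin 3) K}
    (hA : formCongr σ A ((StdForm.antidiagonal 3).over K) = H') (hΓ : Γ = A * T * A⁻¹) {s : Fin 3 → K} (hT : (T : Matrix (Fin 3) (Fin 3) K) = Matrix.diagonal s)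
    (t ℓ m : ℕ) :
    {M : Submodule 𝒪[K] (Fin 3 → K) | IsVertexLattice σ ϖ ((StdForm.antidiagonal 3).over K) t M ∧ mapGL Γ M = M ∧
        LatticeNearTransvShell ϖ ℓ m ((Γ : Matrix (Fin 3) (Fin 3) K) - 1) M}.ncard =
      {M : Submodule 𝒪[K] (Fin 3 → K) | IsVertexLattice σ ϖ H' t M ∧ mapGL T M = M ∧
        (LatticeInLevel ϖ ℓ (Matrix.diagonal fun i => s i - 1) M ∧ ¬ LatticeInLevel ϖ (ℓ + 1) (Matrix.diagonal fun i => s i - 1) M ∧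
          LatticeInLevel ϖ m (Matrix.diagonal fun i => (s i - 1) * (s i - 1)) M)}.ncard := by
  subst hΓ
  rw [← hA, ← diagonal_sub_one_mul_self, ← diagonal_sub_one, ← hT]
  refine (ncard_vertex_fixed_sep_formCongr_eq σ ϖ ((StdForm.antidiagonal 3).over K) A T t _ _ fun M => ?_).symm
  rw [coe_conj_sub_one, latticeNearTransvShell_conj_mapGL_iff]
  rfl

/-- Hence the level token of a diagonal operator is invariant under a diagonal change of basis: `diag(e)·(P·M) ⊆ ϖ^ℓ·(P·M) ↔ diag(e)·M ⊆ ϖ^ℓ·M`, `P = diag(z)`.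
[cite: Jacobowitz1962, §4] [cite: Kottwitz1986BaseChangeUnits, §1 pp. 240–241] -/
theorem latticeInLevel_diagonal_mapGL_iff {P : GL (Fin 3) K} {z : Fin 3 → K} (hP : (P : Matrix (Fin 3) (Fin 3) K) = Matrix.diagonal z)
    (ϖ : K) (ℓ : ℕ) (e : Fin 3 → K) (M : Submodule 𝒪[K] (Fin 3 → K)) :
    LatticeInLevel ϖ ℓ (Matrix.diagonal e) (mapGL P M) ↔ LatticeInLevel ϖ ℓ (Matrix.diagonal e) M := by
  rw [← latticeInLevel_conj_mapGL_iff P ϖ ℓ (Matrix.diagonal e) M, diagonal_conj_diagonal hP]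

/-- **(C) CLASS-ONLY DEPENDENCE WITH A DIAGONAL-INVARIANT LABEL.**  If two diagonal forms `diag(d)`, `diag(d′)` differ entrywise by norms — `σ(z_i)·d_i·z_i = d′_i`,
`z_i ≠ 0` — then for every DIAGONAL `T = diag(s)` and every label `Q` invariant under diagonal changes of basis, the label-cut type-`t` fixed counts agree (`diag(z)` is
a congruence commuting with `T`; §1 (T)): the level counts of a frame depend only on its norm classes `(ε₁, ε₂, ε₃)` (twin of ★ `ncard_fixed_diagonal_eq_of_exists_norm`).
[cite: Jacobowitz1962, §4] [cite: BruhatTits1972, §10] -/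
theorem ncard_vertex_fixed_sep_diagonal_eq_of_exists_norm (σ : K →+* K) (ϖ : K) {d d' : Fin N → K} (h : ∀ i, ∃ z : K, z ≠ 0 ∧ σ z * d i * z = d' i)
    (s : Fin N → K) (T : GL (Fin N) K) (hT : (T : Matrix (Fin N) (Fin N) K) = Matrix.diagonal s) (t : ℕ)
    (Q : Submodule 𝒪[K] (Fin N → K) → Prop)
    (hQ : ∀ (P : GL (Fin N) K) (z : Fin N → K), (P : Matrix (Fin N) (Fin N) K) = Matrix.diagonal z → ∀ M, Q (mapGL P M) ↔ Q M) :
    {M : Submodule 𝒪[K] (Fin N → K) | IsVertexLattice σ ϖ (Matrix.diagonal d') t M ∧ mapGL T M = M ∧ Q M}.ncard =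
      {M : Submodule 𝒪[K] (Fin N → K) | IsVertexLattice σ ϖ (Matrix.diagonal d) t M ∧ mapGL T M = M ∧ Q M}.ncard := by
  classical
  choose z hz0 hz using h
  let P : GL (Fin N) K :=
    ⟨Matrix.diagonal z, Matrix.diagonal fun i => (z i)⁻¹,
      by rw [Matrix.diagonal_mul_diagonal, ← Matrix.diagonal_one]; congr 1; funext i; exact mul_inv_cancel₀ (hz0 i),
      by rw [Matrix.diagonal_mul_diagonal, ← Matrix.diagonal_one]; congr 1; funext i; exact inv_mul_cancel₀ (hz0 i)⟩
  have hP : (P : Matrix (Fin N) (Fin N) K) = Matrix.diagonal z := rfl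
  have hform : formCongr σ P (Matrix.diagonal d) = Matrix.diagonal d' := by
    rw [formCongr, hP, Matrix.diagonal_map (map_zero σ), Matrix.diagonal_transpose, Matrix.diagonal_mul_diagonal, Matrix.diagonal_mul_diagonal]
    congr 1; funext i; exact hz i
  have hcomm : P * T * P⁻¹ = T := Units.ext (by rw [Units.val_mul, Units.val_mul, hT, diagonal_conj_diagonal hP])
  rw [← hform, ncard_vertex_fixed_sep_formCongr_eq σ ϖ (Matrix.diagonal d) P T t Q Q (hQ P z hP), hcomm]

end Transport

/-! ## §3  The four-frame heads: every level ∕ profile count of `Γ_b(α, β)` in the unimodular diagonal model -/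

section Frame

variable {K : Type} [Field K] [Valued K ℤᵐ⁰] {σ : K →+* K} {ϖ : K}

/-- **FIXED COUNT OF A CONJUGATE OF A DIAGONAL MATRIX** (★ `ncard_fixed_formCongr_eq`, re-keyed to `Γ = A·T·A⁻¹` so that it rides in the SAME model as the level
counts above): `fixedVertexCount σ ϖ t Γ = #{M : type t for H′, T·M = M}`. [cite: Kottwitz1986BaseChangeUnits, §1 pp. 240–241] [cite: BruhatTits1972, §10] -/
theorem fixedVertexCount_conj {H' : Matrix (Fin 3) (Fin 3) K} {A T Γ : GL (Fin 3) K}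
    (hA : formCongr σ A ((StdForm.antidiagonal 3).over K) = H') (hΓ : Γ = A * T * A⁻¹) (t : ℕ) :
    fixedVertexCount σ ϖ t Γ = {M : Submodule 𝒪[K] (Fin 3 → K) | IsVertexLattice σ ϖ H' t M ∧ mapGL T M = M}.ncard := by
  subst hΓ
  rw [fixedVertexCount, ← hA]
  exact (ncard_fixed_formCongr_eq σ ϖ ((StdForm.antidiagonal 3).over K) A T t).symm

/-- **MASTER HEAD — THE UNIMODULAR DIAGONAL MODEL OF A FOUR-FRAME WITH ITS CHANGE OF BASIS AND A GENERIC LABEL.**  Under the datum clauses, for a four-frame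
family `f` and a frame `b`: `A ∈ GL₃(K)` and a unit diagonal form `diag(d)` (`|d_i| = 1`, `σ d_i = d_i`, `ω(d_i) = ω(N_i)`) with `ᵗσ(A)·Φ₃·A = diag(d)`, `Γ_b(α, β) =
A·diag(α, β, 1)·A⁻¹`, and for every `Γ = A·T·A⁻¹`, every vertex type `t` and every pair of labels with `Q₁ (A·M) ↔ Q₂ M`: `#{M : type t for Φ₃, Γ·M = M, Q₁ M} =
#{M : type t for diag(d), T·M = M, Q₂ M}` (★ `exists_unimodular_diagonal_frame` + §1 (T)); every profile census whose tokens transport is an instance.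
[cite: Rogawski1990, §4.9 Prop. 4.9.1 (a)(b) p. 55] [cite: Kottwitz1986BaseChangeUnits, §1 pp. 240–241] [cite: BruhatTits1972, §10] -/
theorem exists_diagonal_model_frame (hσ : ∀ x, σ (σ x) = x) (hvσ : ∀ a, Valued.v (σ a) = Valued.v a)
    (hϖ : Valued.v ϖ = WithZero.exp (-1 : ℤ)) (heven : ∀ x : K, σ x = x → x ≠ 0 → ∃ n : ℤ, Valued.v x = WithZero.exp (2 * n))
    {f : Fin 4 → Fin 3 → (Fin 3 → K)} (hf : IsFourFrameFamily σ f) (b : Fin 4) :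
    ∃ (A : GL (Fin 3) K) (d : Fin 3 → K), (∀ i, Valued.v (d i) = 1) ∧ (∀ i, σ (d i) = d i) ∧
      (∀ i, normSign σ (d i) = normSign σ (pairing σ ((StdForm.antidiagonal 3).over K) (f b i) (f b i))) ∧
      formCongr σ A ((StdForm.antidiagonal 3).over K) = Matrix.diagonal d ∧
      (∀ α β : K, frameElt σ f b α β =
        (A : Matrix (Fin 3) (Fin 3) K) * Matrix.diagonal ![α, β, 1] * ((A⁻¹ : GL (Fin 3) K) : Matrix (Fin 3) (Fin 3) K)) ∧
      ∀ (T Γ : GL (Fin 3) K), Γ = A * T * A⁻¹ →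
        ∀ (t : ℕ) (Q₁ Q₂ : Submodule 𝒪[K] (Fin 3 → K) → Prop), (∀ M, Q₁ (mapGL A M) ↔ Q₂ M) →
          {M : Submodule 𝒪[K] (Fin 3 → K) | IsVertexLattice σ ϖ ((StdForm.antidiagonal 3).over K) t M ∧ mapGL Γ M = M ∧ Q₁ M}.ncard =
            {M : Submodule 𝒪[K] (Fin 3 → K) | IsVertexLattice σ ϖ (Matrix.diagonal d) t M ∧ mapGL T M = M ∧ Q₂ M}.ncard := by
  obtain ⟨A, d, hd, hσd, hcls, hA, hconj⟩ := exists_unimodular_diagonal_frame hσ hvσ hϖ heven hf b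
  refine ⟨A, d, hd, hσd, hcls, hA, hconj, fun T Γ hΓ t Q₁ Q₂ hQ => ?_⟩
  rw [hΓ, ← hA]
  exact (ncard_vertex_fixed_sep_formCongr_eq σ ϖ ((StdForm.antidiagonal 3).over K) A T t Q₁ Q₂ hQ).symm

omit [Valued K ℤᵐ⁰] in
/-- The frame element of frame `b` is the `A`-conjugate of `diag(α, β, 1)`, as an identity in `GL₃` (from the matrix identity of ★ `exists_unimodular_diagonal_frame`).
[cite: Rogawski1990, §3.6 pp. 28–29] -/
theorem eq_conj_of_coe_eq_frameElt {f : Fin 4 → Fin 3 → (Fin 3 → K)} {b : Fin 4} {A : GL (Fin 3) K}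
    (hconj : ∀ α β : K, frameElt σ f b α β =
      (A : Matrix (Fin 3) (Fin 3) K) * Matrix.diagonal ![α, β, 1] * ((A⁻¹ : GL (Fin 3) K) : Matrix (Fin 3) (Fin 3) K))
    {α β : K} {T Γ : GL (Fin 3) K} (hT : (T : Matrix (Fin 3) (Fin 3) K) = Matrix.diagonal ![α, β, 1])
    (hΓ : (Γ : Matrix (Fin 3) (Fin 3) K) = frameElt σ f b α β) : Γ = A * T * A⁻¹ :=
  Units.ext (by rw [hΓ, hconj α β, Units.val_mul, Units.val_mul, hT])

omit [Valued K ℤᵐ⁰] in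
/-- The literal `z·Γ_b(α, β)` is the `A`-conjugate of `diag(zα, zβ, z)`, as an identity in `GL₃`. [cite: Rogawski1990, §4.9 p. 54] -/
theorem eq_conj_of_coe_eq_smul_frameElt {f : Fin 4 → Fin 3 → (Fin 3 → K)} {b : Fin 4} {A : GL (Fin 3) K}
    (hconj : ∀ α β : K, frameElt σ f b α β =
      (A : Matrix (Fin 3) (Fin 3) K) * Matrix.diagonal ![α, β, 1] * ((A⁻¹ : GL (Fin 3) K) : Matrix (Fin 3) (Fin 3) K))
    {z α β : K} {T Γ : GL (Fin 3) K} (hT : (T : Matrix (Fin 3) (Fin 3) K) = Matrix.diagonal ![z * α, z * β, z])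
    (hΓ : (Γ : Matrix (Fin 3) (Fin 3) K) = z • frameElt σ f b α β) : Γ = A * T * A⁻¹ :=
  Units.ext (by rw [hΓ, hconj α β, smul_conj, smul_diagonal_three_one, Units.val_mul, Units.val_mul, hT])

/-- **HEAD — THE LEVEL ∕ PROFILE CENSUS OF A FRAME ELEMENT IN THE UNIMODULAR DIAGONAL MODEL, ALL COUNTS IN ONE MODEL.**  Under the datum clauses, for a four-frame
family `f` and a frame `b` there is a unit diagonal form `h_d = diag(d)` — `|d_i| = 1`, `σ d_i = d_i`, `ω(d_i) = ω(N_i)` (so `(ω(d₁), ω(d₂)) = signPair b`) — such that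
for ALL `α, β`, every `T ∈ GL₃` with matrix `diag(α, β, 1)` and every `Γ ∈ GL₃` with matrix `Γ_b(α, β) = frameElt σ f b α β`, writing `D₁ = diag(α − 1, β − 1, 0)` and
`D₂ = diag((α − 1)², (β − 1)², 0)`: (0) `fixedVertexCount σ ϖ t Γ = #{M : type t for h_d, T·M = M}` (★ head, same model); (i) `#{M : type t for Φ₃, Γ·M = M,
(Γ−1)M ⊆ ϖ^aM, (Γ−1)²M ⊆ ϖ^cM} = #{M : type t for h_d, T·M = M, D₁M ⊆ ϖ^aM, D₂M ⊆ ϖ^cM}` (the (D-G-levels) currency); (ii) the square-level count; (iii) `regFixCount σ ϖ m Γ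
= #{M : type 0 for h_d, T·M = M, ¬ D₂M ⊆ ϖ^mM}`; (iv) the unlabelled shell count at `(ℓ, m)`.  Step (1) of the (S)∕(K) reductions for every STAGE-1b level law.
[cite: Rogawski1990, §4.9 Prop. 4.9.1 (a)(b) p. 55] [cite: Kottwitz1986BaseChangeUnits, §1 pp. 240–241] [cite: BruhatTits1972, §10] -/
theorem exists_diagonal_model_levelCounts (hσ : ∀ x, σ (σ x) = x) (hvσ : ∀ a, Valued.v (σ a) = Valued.v a)
    (hϖ : Valued.v ϖ = WithZero.exp (-1 : ℤ)) (heven : ∀ x : K, σ x = x → x ≠ 0 → ∃ n : ℤ, Valued.v x = WithZero.exp (2 * n))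
    {f : Fin 4 → Fin 3 → (Fin 3 → K)} (hf : IsFourFrameFamily σ f) (b : Fin 4) :
    ∃ d : Fin 3 → K, (∀ i, Valued.v (d i) = 1) ∧ (∀ i, σ (d i) = d i) ∧
      (∀ i, normSign σ (d i) = normSign σ (pairing σ ((StdForm.antidiagonal 3).over K) (f b i) (f b i))) ∧
      ∀ (α β : K) (T Γ : GL (Fin 3) K), (T : Matrix (Fin 3) (Fin 3) K) = Matrix.diagonal ![α, β, 1] →
        (Γ : Matrix (Fin 3) (Fin 3) K) = frameElt σ f b α β →
        (∀ t : ℕ, fixedVertexCount σ ϖ t Γ =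
            {M : Submodule 𝒪[K] (Fin 3 → K) | IsVertexLattice σ ϖ (Matrix.diagonal d) t M ∧ mapGL T M = M}.ncard) ∧
        (∀ t a c : ℕ,
          {M : Submodule 𝒪[K] (Fin 3 → K) | IsVertexLattice σ ϖ ((StdForm.antidiagonal 3).over K) t M ∧ mapGL Γ M = M ∧
              (LatticeInLevel ϖ a ((Γ : Matrix (Fin 3) (Fin 3) K) - 1) M ∧
                LatticeInLevel ϖ c (((Γ : Matrix (Fin 3) (Fin 3) K) - 1) * ((Γ : Matrix (Fin 3) (Fin 3) K) - 1)) M)}.ncard =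
            {M : Submodule 𝒪[K] (Fin 3 → K) | IsVertexLattice σ ϖ (Matrix.diagonal d) t M ∧ mapGL T M = M ∧
              (LatticeInLevel ϖ a (Matrix.diagonal ![α - 1, β - 1, 0]) M ∧
                LatticeInLevel ϖ c (Matrix.diagonal ![(α - 1) * (α - 1), (β - 1) * (β - 1), 0]) M)}.ncard) ∧
        (∀ t c : ℕ,
          {M : Submodule 𝒪[K] (Fin 3 → K) | IsVertexLattice σ ϖ ((StdForm.antidiagonal 3).over K) t M ∧ mapGL Γ M = M ∧
              LatticeInLevel ϖ c (((Γ : Matrix (Fin 3) (Fin 3) K) - 1) * ((Γ : Matrix (Fin 3) (Fin 3) K) - 1)) M}.ncard =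
            {M : Submodule 𝒪[K] (Fin 3 → K) | IsVertexLattice σ ϖ (Matrix.diagonal d) t M ∧ mapGL T M = M ∧
              LatticeInLevel ϖ c (Matrix.diagonal ![(α - 1) * (α - 1), (β - 1) * (β - 1), 0]) M}.ncard) ∧
        (∀ m : ℕ, regFixCount σ ϖ m Γ =
            {M : Submodule 𝒪[K] (Fin 3 → K) | IsVertexLattice σ ϖ (Matrix.diagonal d) 0 M ∧ mapGL T M = M ∧
              ¬ LatticeInLevel ϖ m (Matrix.diagonal ![(α - 1) * (α - 1), (β - 1) * (β - 1), 0]) M}.ncard) ∧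
        (∀ t ℓ m : ℕ,
          {M : Submodule 𝒪[K] (Fin 3 → K) | IsVertexLattice σ ϖ ((StdForm.antidiagonal 3).over K) t M ∧ mapGL Γ M = M ∧
              LatticeNearTransvShell ϖ ℓ m ((Γ : Matrix (Fin 3) (Fin 3) K) - 1) M}.ncard =
            {M : Submodule 𝒪[K] (Fin 3 → K) | IsVertexLattice σ ϖ (Matrix.diagonal d) t M ∧ mapGL T M = M ∧
              (LatticeInLevel ϖ ℓ (Matrix.diagonal ![α - 1, β - 1, 0]) M ∧ ¬ LatticeInLevel ϖ (ℓ + 1) (Matrix.diagonal ![α - 1, β - 1, 0]) M ∧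
                LatticeInLevel ϖ m (Matrix.diagonal ![(α - 1) * (α - 1), (β - 1) * (β - 1), 0]) M)}.ncard) := by
  obtain ⟨A, d, hd, hσd, hcls, hA, hconj, -⟩ := exists_diagonal_model_frame hσ hvσ hϖ heven hf b
  refine ⟨d, hd, hσd, hcls, fun α β T Γ hT hΓ => ?_⟩
  have hΓ' : Γ = A * T * A⁻¹ := eq_conj_of_coe_eq_frameElt hconj hT hΓ
  have hD₁ : (Matrix.diagonal fun i => ![α, β, 1] i - 1) = Matrix.diagonal ![α - 1, β - 1, 0] := by
    rw [← diagonal_sub_one, diagonal_three_sub_one, sub_self]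
  have hD₂ : (Matrix.diagonal fun i => (![α, β, 1] i - 1) * (![α, β, 1] i - 1)) = Matrix.diagonal ![(α - 1) * (α - 1), (β - 1) * (β - 1), 0] := by
    rw [← diagonal_sub_one_mul_self, diagonal_three_sub_one_mul_self, sub_self, mul_zero]
  refine ⟨fun t => fixedVertexCount_conj hA hΓ' t, fun t a c => ?_, fun t c => ?_, fun m => ?_, fun t ℓ m => ?_⟩
  · rw [ncard_levels_conj_diagonal σ ϖ hA hΓ' hT, hD₁, hD₂]
  · rw [ncard_sqLevel_conj_diagonal σ ϖ hA hΓ' hT, hD₂]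
  · rw [regFixCount_conj_diagonal σ ϖ hA hΓ' hT, hD₂]
  · rw [ncard_shell_conj_diagonal σ ϖ hA hΓ' hT, hD₁, hD₂]

end Frame

end Summit.HodgeConjecture.HodgeConjecture.Cruxes.H413.F0P3cDyRamLevelCountDiagonalModel

end
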